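import Summits.QuantumAdvantage.QuantumAdvantage.Theorems.CharDialSegmentMovesI
import HarnessLib
import Summits.QuantumAdvantage.AdviceFreeQNC0.ExactHit
import Summits.QuantumAdvantage.AdviceFreeQNC0.TransferWalk

/-!
# CharDial — segment moves, part J: exact side information ⇒ perfect play (where the side-information attack fails)

Support for `CharDial.WalkHardFJLinOdd` (stmt-QuantumAdvantage-32604), continuing part I.  A NEGATIVE rung for the side-information attack on
the Young slice (parts G–I): if every class of the assignment has `< p` elements, the class popcounts mod `p` are the popcounts, so the side
information determines `W(u)` exactly, and the junta-free two-cut strategy «cut 0 fires iff `c + W ≢ 0 (mod 3)`, cut 1 fires iff `c + W ≡ 0`»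
wins on EVERY input (`firstLive_wins`: cut 0 is live iff `c + W ≢ 0`; if it is dead, cut 1's address is `≡ 1 + u₀ ∈ {1,2}`).  Prop-free
consequences: `sideInfo_perfect_of_small_classes` and `sideInfo_small_not_hard` (at `p = 5`, classes of size `4 = p − 1`: for every `θ < 1`
and `n₀` an instance beyond `n₀` with MORE than `θ·2ⁿ` wins) — the side-information reduction is void below class size `p`; the slice's
schedule `p(8 log₂ n + 9) − 1` is above it by the factor `8 log₂ n + 9`.  Nothing here bears on Young FORMS data or on the blocker.
-/

set_option autoImplicit false

namespace Summit.QuantumAdvantage.AdviceFreeQNC0.JLinPeel.SegMove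

open Finset
open Summit.QuantumAdvantage.AdviceFreeQNC0

variable {n : ℕ} {p : ℕ}

/-- the comb classes of `Fin n` with `n ≤ k·B` have `≤ k` elements. -/
theorem card_combClass_le {B b k : ℕ} (hB : 0 < B) (hn : n ≤ k * B) : (combClass n B b).card ≤ k := by
  have hcard : (univ : Finset (Fin k)).card = k := by simp
  rw [← hcard]
  have hdiv : ∀ i : Fin n, i.val / B < k := fun i => (Nat.div_lt_iff_lt_mul hB).mpr (lt_of_lt_of_le i.isLt hn)
  refine Finset.card_le_card_of_injOn (fun i : Fin n => (⟨i.val / B, hdiv i⟩ : Fin k)) (fun i _ => mem_coe.mpr (mem_univ _)) ?_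
  intro i hi j hj hij
  rw [mem_coe, combClass, mem_filter] at hi hj
  have hq : i.val / B = j.val / B := by
    have := congrArg Fin.val hij
    simpa using this
  apply Fin.ext
  rw [← Nat.div_add_mod i.val B, ← Nat.div_add_mod j.val B, hq, hi.2, hj.2]

/-- with all classes of size `< p`, the residues are the popcounts: `Σ_b (classRes p π u b).val = wt u`. -/
theorem sum_val_classRes [NeZero p] {B : ℕ} (π : Fin n → Fin B) (hπ : ∀ b, (univ.filter fun i : Fin n => π i = b).card < p)
    (u : Fin n → Bool) : ∑ b, (classRes p π u b).val = wt u := by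
  have h1 : ∀ b, (classRes p π u b).val = (univ.filter fun i : Fin n => π i = b ∧ u i = true).card := by
    intro b
    show (((univ.filter fun i : Fin n => π i = b ∧ u i = true).card : ℕ) : ZMod p).val = _
    rw [ZMod.val_natCast]
    apply Nat.mod_eq_of_lt
    refine lt_of_le_of_lt (Finset.card_le_card fun i hi => ?_) (hπ b)
    simp only [mem_filter, mem_univ, true_and] at hi ⊢
    exact hi.1
  simp_rw [h1]
  unfold wt
  rw [Finset.card_eq_sum_card_fiberwise (f := π) (t := (univ : Finset (Fin B))) fun i _ => mem_univ _]
  refine Finset.sum_congr rfl fun b _ => ?_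
  rw [Finset.filter_filter]
  congr 1
  ext i
  simp only [mem_filter, mem_univ, true_and]
  exact and_comm

/-- the two-cut side-information strategy: cut 0 fires iff `c + Σ_b r_b ≢ 0 (mod 3)`, cut 1 iff `≡ 0`, all other cuts never. -/
def firstLiveH (c B p n : ℕ) : Fin (n + 1) → (Fin B → ZMod p) → Bool := fun g r =>
  if g.val = 0 then decide ((c + ∑ b, (r b).val) % 3 ≠ 0)
  else if g.val = 1 then decide ((c + ∑ b, (r b).val) % 3 = 0) else false

/-- **perfect play from exact side information.**  With all classes of size `< p` (and `n ≥ 1`), the two-cut strategy wins on EVERY input. -/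
theorem firstLive_wins [NeZero p] (hn : 1 ≤ n) (c : ℕ) {B : ℕ} (π : Fin n → Fin B)
    (hπ : ∀ b, (univ.filter fun i : Fin n => π i = b).card < p) (u : Fin n → Bool) :
    ringWinU c (fun g u => firstLiveH c B p n g (classRes p π u)) u = true := by
  have hW : ∑ b, (classRes p π u b).val = wt u := sum_val_classRes π hπ u
  have h0w : walkExp u 0 = wt u := by unfold walkExp; rw [Summit.QuantumAdvantage.AdviceFreeQNC0.TransferWalk.wtPrefix_zero]; rfl
  have h1w : walkExp u 1 ≤ wt u + 1 := by unfold walkExp; have := Summit.QuantumAdvantage.AdviceFreeQNC0.ExactHit.wtPrefix_one_le u; omega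
  have h1w' : wt u ≤ walkExp u 1 := by unfold walkExp; omega
  unfold ringWinU
  rw [decide_eq_true_eq]
  set g₀ : Fin (n + 1) := ⟨0, by omega⟩ with hg₀
  set g₁ : Fin (n + 1) := ⟨1, by omega⟩ with hg₁
  have hg0v : g₀.val = 0 := rfl
  have hg1v : g₁.val = 1 := rfl
  by_cases hc : (c + wt u) % 3 = 0
  · have hS : (univ.filter fun g : Fin (n + 1) =>
        (fun g u => firstLiveH c B p n g (classRes p π u)) g u = true ∧ (c + g.val + walkExp u g.val) % 3 ≠ 0) = {g₁} := by
      ext g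
      simp only [mem_filter, mem_univ, true_and, mem_singleton, firstLiveH, hW]
      constructor
      · rintro ⟨hf, -⟩
        by_cases hg0 : g.val = 0
        · rw [if_pos hg0, decide_eq_true_eq] at hf
          exact absurd hc hf
        · rw [if_neg hg0] at hf
          by_cases hg1 : g.val = 1
          · exact Fin.ext (by rw [hg1, hg1v])
          · rw [if_neg hg1] at hf
            exact absurd hf Bool.false_ne_true
      · intro hg
        subst hg
        refine ⟨?_, ?_⟩
        · rw [hg1v]; simp [hc]
        · rw [hg1v]; omega
    rw [hS, card_singleton]
  · have hS : (univ.filter fun g : Fin (n + 1) =>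
        (fun g u => firstLiveH c B p n g (classRes p π u)) g u = true ∧ (c + g.val + walkExp u g.val) % 3 ≠ 0) = {g₀} := by
      ext g
      simp only [mem_filter, mem_univ, true_and, mem_singleton, firstLiveH, hW]
      constructor
      · rintro ⟨hf, -⟩
        by_cases hg0 : g.val = 0
        · exact Fin.ext (by rw [hg0, hg0v])
        · rw [if_neg hg0] at hf
          by_cases hg1 : g.val = 1
          · rw [if_pos hg1, decide_eq_true_eq] at hf
            exact absurd hf hc
          · rw [if_neg hg1] at hf
            exact absurd hf Bool.false_ne_true
      · intro hg
        subst hg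
        refine ⟨?_, ?_⟩
        · rw [hg0v]; simp [hc]
        · rw [hg0v, h0w]; omega
    rw [hS, card_singleton]

/-- **exact side information ⇒ perfect play** (existential form). -/
theorem sideInfo_perfect_of_small_classes [NeZero p] (hn : 1 ≤ n) (c : ℕ) {B : ℕ} (π : Fin n → Fin B)
    (hπ : ∀ b, (univ.filter fun i : Fin n => π i = b).card < p) :
    ∃ H : Fin (n + 1) → (Fin B → ZMod p) → Bool, ∀ u, ringWinU c (fun g u => H g (classRes p π u)) u = true :=
  ⟨firstLiveH c B p n, firstLive_wins hn c π hπ⟩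

/-- ★ **negative rung (Prop-free): below class size `p` the side-information strategies are NOT hard.**  At `p = 5`: for every `θ < 1` and
every `n₀` there are `n ≥ n₀`, an assignment with all classes of size `≥ 4 = p − 1`, and junta-free tables of the class popcounts mod `5` whose
strategy wins on MORE than `θ·2ⁿ` inputs (indeed on all of them; comb classes of `n = 4B`). -/
theorem sideInfo_small_not_hard (θ : ℝ) (hθ : θ < 1) (n₀ : ℕ) :
    ∃ n ≥ n₀, ∃ (B : ℕ) (π : Fin n → Fin B), (∀ b, 5 - 1 ≤ (univ.filter fun i : Fin n => π i = b).card) ∧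
      ∃ H : Fin (n + 1) → (Fin B → ZMod 5) → Bool,
        θ * (2 : ℝ) ^ n < ((univ.filter fun u : Fin n → Bool => ringWinU 0 (fun g u => H g (classRes 5 π u)) u = true).card : ℝ) := by
  haveI : Fact (Nat.Prime 5) := ⟨by norm_num⟩
  obtain ⟨B, hB0, hBn⟩ : ∃ B : ℕ, 0 < B ∧ n₀ ≤ 4 * B := ⟨n₀ + 1, by omega, by omega⟩
  have hdiv : 4 * B / B = 4 := Nat.mul_div_cancel 4 hB0
  let π : Fin (4 * B) → Fin B := fun i => ⟨i.val % B, Nat.mod_lt _ hB0⟩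
  have hcls : ∀ b : Fin B, (univ.filter fun i : Fin (4 * B) => π i = b) = combClass (4 * B) B b.val := by
    intro b; unfold combClass; ext i; simp [π, Fin.ext_iff]
  have hge : ∀ b : Fin B, 5 - 1 ≤ (univ.filter fun i : Fin (4 * B) => π i = b).card := by
    intro b; rw [hcls]; have := card_combClass_ge (n := 4 * B) hB0 b.isLt; omega
  have hlt : ∀ b : Fin B, (univ.filter fun i : Fin (4 * B) => π i = b).card < 5 := by
    intro b; rw [hcls]; have := card_combClass_le (n := 4 * B) (b := b.val) (k := 4) hB0 le_rfl; omega
  refine ⟨4 * B, hBn, B, π, hge, firstLiveH 0 B 5 (4 * B), ?_⟩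
  have hall : (univ.filter fun u : Fin (4 * B) → Bool =>
      ringWinU 0 (fun g u => firstLiveH 0 B 5 (4 * B) g (classRes 5 π u)) u = true) = univ :=
    Finset.filter_true_of_mem fun u _ => firstLive_wins (by omega) 0 π hlt u
  rw [hall, Finset.card_univ, Fintype.card_fun, Fintype.card_bool, Fintype.card_fin]
  push_cast
  have h2 : (0 : ℝ) < (2 : ℝ) ^ (4 * B) := by positivity
  nlinarith

end Summit.QuantumAdvantage.AdviceFreeQNC0.JLinPeel.SegMove
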